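import Mathlib
import HarnessLib

/-!
# Adapted generators of a parameter ideal around a given parameter

Support file for crux `FRationalModification` (route `ResolutionOfSingularities/FrobeniusLadder`,
line `Sketch`, stub `stub_adaptedGenerators`). Pure dimension theory over Mathlib (heights of
ideals, minimal primes, prime avoidance, Nakayama); no tight closure and no characteristic.

Let `(R, 𝔪)` be a Noetherian local domain of dimension `d + 1`, `g ∈ 𝔪` with `g ≠ 0`, and
`t : Fin (d + 1) → R` with `rad (t) = 𝔪` (a system of parameters). Then `(t) = (b, u)` for
`b := t 0` and some `u : Fin d → R` such that `(g, u)` is again a parameter ideal,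
`rad (g, u) = 𝔪` (`stub_adaptedGenerators`).

Proof. Write `J := (t)`. We build `u₀, …, u_{d-1}` with `uₖ ≡ t_{k+1} (mod 𝔪J)` such that
`Kᵢ := (g, u₀, …, u_{i-1})` has height `≥ i + 1`:

* `height (g) ≥ 1` since `g` is a non-zero-divisor
  (`Ideal.one_le_height_span_singleton_of_mem_nonZeroDivisors`);
* (coset prime avoidance à la Davis, Kaplansky *Commutative Rings*, Thm. 124,
  `exists_add_notMem_of_subset_minimalPrimes`) if `S` is a finite set of minimal primes of one
  ideal and `I ⊄ P` for all `P ∈ S`, then every coset `x₀ + I` meets the complement of `⋃ S`;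
* (height climbing, `exists_le_height_sup_span_singleton`) applied with `S` the minimal primes of
  `Kᵢ` of height exactly `i + 1` and `I = 𝔪J`: no such prime contains `𝔪J` (it would contain
  `𝔪 = rad J`, of height `d + 1 > i + 1`), so some `uᵢ ∈ t_{i+1} + 𝔪J` avoids them all, and then
  every minimal prime of `K_{i+1} = Kᵢ + (uᵢ)` has height `≥ i + 2`
  (`Ideal.mem_minimalPrimes_of_height_eq`).

At `i = d`, `K_d ≤ 𝔪` has height `d + 1 = dim R`, so all primes over `K_d` equal `𝔪`
(`Ideal.height_eq_ringKrullDim_iff`) and `rad K_d = 𝔪`; and `J ≤ (t 0, u) + 𝔪J` gives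
`J = (t 0, u)` by Nakayama (`Submodule.le_of_le_smul_of_le_jacobson_bot`).

## References

* I. Kaplansky, *Commutative Rings*, revised ed., Univ. of Chicago Press 1974, Thm. 124
  (E. Davis' prime avoidance for cosets). Folklore.
-/

-- the summit and its single problem share the name `ResolutionOfSingularities` (path-aligned
-- namespace), which forces a duplicated segment
set_option linter.dupNamespace false

namespace Summit.ResolutionOfSingularities.ResolutionOfSingularities.Theorems.FRationalModification.AdaptedGenerators

open IsLocalRing

section Avoidance

variable {R : Type*} [CommRing R]

/-- **Coset prime avoidance** (E. Davis; Kaplansky, *Commutative Rings*, Thm. 124), in the form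
needed here: if `S` is a finite set of minimal primes of one ideal `K` (hence pairwise
incomparable) and the ideal `I` is contained in no `P ∈ S`, then for every `x₀` some element of the
coset `x₀ + I` lies outside every `P ∈ S`. [folklore] -/
theorem exists_add_notMem_of_subset_minimalPrimes {K I : Ideal R} {S : Set (Ideal R)}
    (hS : S.Finite) (hSK : S ⊆ K.minimalPrimes) (hI : ∀ P ∈ S, ¬ I ≤ P) (x₀ : R) :
    ∃ y ∈ I, ∀ P ∈ S, x₀ + y ∉ P := by
  classical
  -- the primes of `S` containing / not containing `x₀`
  have hS₁ : {P ∈ S | x₀ ∈ P}.Finite := hS.subset (Set.sep_subset _ _)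
  have hS₂ : {P ∈ S | x₀ ∉ P}.Finite := hS.subset (Set.sep_subset _ _)
  -- `I' := I ⊓ ⋂ {P ∈ S | x₀ ∉ P}` is contained in no `P ∈ S` with `x₀ ∈ P`
  have havoid : ¬ ((↑(I ⊓ hS₂.toFinset.inf id) : Set R) ⊆ ⋃ P ∈ {P ∈ S | x₀ ∈ P}, (P : Set R)) := by
    rw [Ideal.subset_union_prime_finite hS₁ ⊥ ⊥ (fun P hP _ _ => (hSK hP.1).1.1)]
    rintro ⟨P, ⟨hPS, hxP⟩, hle⟩
    have hP : P.IsPrime := (hSK hPS).1.1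
    rcases hP.inf_le.mp hle with h | h
    · exact hI P hPS h
    · obtain ⟨Q, hQ, hQP⟩ := hP.inf_le'.mp h
      rw [hS₂.mem_toFinset] at hQ
      -- `Q ≤ P` are both minimal primes of `K`, hence `P ≤ Q`, contradicting `x₀ ∈ P \ Q`
      exact hQ.2 ((hSK hPS).2 ⟨(hSK hQ.1).1.1, (hSK hQ.1).1.2⟩ hQP hxP)
  obtain ⟨y, hyI', hy⟩ := Set.not_subset.mp havoid
  refine ⟨y, (inf_le_left (a := I)) hyI', fun P hPS hxy => ?_⟩
  by_cases hxP : x₀ ∈ P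
  · exact hy (Set.mem_biUnion (x := P) ⟨hPS, hxP⟩ ((P.add_mem_iff_right hxP).mp hxy))
  · have hle : I ⊓ hS₂.toFinset.inf id ≤ P :=
      inf_le_right.trans (Finset.inf_le (hS₂.mem_toFinset.mpr ⟨hPS, hxP⟩))
    exact hxP ((P.add_mem_iff_left (hle hyI')).mp hxy)

/-- **Height climbing inside a coset.** In a Noetherian ring let `r ≤ height K` and let `I` be an
ideal contained in no minimal prime of `K` of height exactly `r`. Then for every `x₀` there is
`y ∈ I` with `r + 1 ≤ height (K + (x₀ + y))`: by coset prime avoidance `x₀ + y` avoids the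
(finitely many) minimal primes of `K` of height `r`, and a minimal prime of `K + (x₀ + y)` of
height `r` would be one of them (`Ideal.mem_minimalPrimes_of_height_eq`). This is the inductive step
of the usual construction of systems of parameters, run inside the coset `x₀ + I`. [folklore] -/
theorem exists_le_height_sup_span_singleton [IsNoetherianRing R] {K I : Ideal R} {r : ℕ}
    (hr : (r : ℕ∞) ≤ K.height) (hI : ∀ P ∈ K.minimalPrimes, P.height = r → ¬ I ≤ P) (x₀ : R) :
    ∃ y ∈ I, (r : ℕ∞) + 1 ≤ (K ⊔ Ideal.span {x₀ + y}).height := by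
  have hS : {P ∈ K.minimalPrimes | P.height = r}.Finite :=
    K.finite_minimalPrimes_of_isNoetherianRing.subset (Set.sep_subset _ _)
  obtain ⟨y, hyI, hy⟩ := exists_add_notMem_of_subset_minimalPrimes hS (Set.sep_subset _ _)
    (fun P hP => hI P hP.1 hP.2) x₀
  refine ⟨y, hyI, ?_⟩
  rw [(K ⊔ Ideal.span {x₀ + y}).height_eq_inf_minimalPrimes]
  refine le_iInf₂ fun P hP => ?_
  have hPprime : P.IsPrime := hP.1.1
  have hKP : K ≤ P := le_sup_left.trans hP.1.2
  rcases (hr.trans (Ideal.height_mono hKP)).lt_or_eq with hlt | heq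
  · exact Order.add_one_le_of_lt hlt
  · exfalso
    refine hy P ⟨Ideal.mem_minimalPrimes_of_height_eq hKP (heq ▸ hr), heq.symm⟩ ?_
    exact hP.1.2 (Ideal.mem_sup_right (Ideal.mem_span_singleton_self _))

end Avoidance

/-- **Adapted generators** (stub `stub_adaptedGenerators` of line `Sketch`). Let `(R, 𝔪)` be a
Noetherian local domain of dimension `d + 1`, `g ∈ 𝔪`, `g ≠ 0`, and `t : Fin (d + 1) → R` with
`rad (t) = 𝔪`. Then `(t) = (b, u)` for some `b` and some `u : Fin d → R` with `rad (g, u) = 𝔪`.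
Proof: perturb `t₁, …, t_d` inside their cosets modulo `𝔪 · (t)` so that the heights of
`(g, u₀, …, u_{i-1})` climb to `d + 1` (coset prime avoidance à la Davis, Kaplansky Thm. 124), and
`(t 0, u) = (t)` by Nakayama. [folklore] -/
theorem stub_adaptedGenerators {R : Type*} [CommRing R] [IsDomain R] [IsNoetherianRing R]
    [IsLocalRing R] {d : ℕ} (hd : ringKrullDim R = ((d + 1 : ℕ) : WithBot ℕ∞)) {g : R}
    (hg : g ∈ maximalIdeal R) (hg0 : g ≠ 0) (t : Fin (d + 1) → R)
    (ht : (Ideal.span (Set.range t)).radical = maximalIdeal R) :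
    ∃ (b : R) (u : Fin d → R), Ideal.span (Set.range t) = Ideal.span (insert b (Set.range u)) ∧
      (Ideal.span (insert g (Set.range u))).radical = maximalIdeal R := by
  set J : Ideal R := Ideal.span (Set.range t) with hJ_def
  -- `height 𝔪 = d + 1`
  have h𝔪 : (maximalIdeal R).height = ((d + 1 : ℕ) : ℕ∞) := by
    have h := IsLocalRing.maximalIdeal_height_eq_ringKrullDim (R := R)
    rw [hd] at h
    exact_mod_cast h
  have hJ𝔪 : J ≤ maximalIdeal R := ht ▸ Ideal.le_radical
  -- a prime containing `𝔪 * J` contains `𝔪`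
  have hbig : ∀ P : Ideal R, P.IsPrime → maximalIdeal R * J ≤ P → maximalIdeal R ≤ P := by
    intro P hP h
    rcases hP.mul_le.mp h with h | h
    · exact h
    · exact ht ▸ hP.radical_le_iff.mpr h
  -- the inductive construction of `u₀, …, u_{i-1}`
  have key : ∀ i ≤ d, ∃ u : Fin i → R,
      (∀ (k : Fin i) (j : Fin (d + 1)), (k : ℕ) + 1 = j → u k - t j ∈ maximalIdeal R * J) ∧
      ((i + 1 : ℕ) : ℕ∞) ≤ (Ideal.span (insert g (Set.range u))).height := by
    intro i
    induction i with
    | zero =>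
      intro _
      refine ⟨fun k => k.elim0, fun k => k.elim0, ?_⟩
      simpa using Ideal.one_le_height_span_singleton_of_mem_nonZeroDivisors
        (mem_nonZeroDivisors_of_ne_zero hg0)
    | succ i ih =>
      intro hi
      obtain ⟨u, hu, hK⟩ := ih (Nat.le_of_succ_le hi)
      set K : Ideal R := Ideal.span (insert g (Set.range u)) with hK_def
      have hI : ∀ P ∈ K.minimalPrimes, P.height = ((i + 1 : ℕ) : ℕ∞) →
          ¬ maximalIdeal R * J ≤ P := by
        intro P hP hPh hle
        have h1 : (maximalIdeal R).height ≤ P.height := Ideal.height_mono (hbig P hP.1.1 hle)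
        rw [h𝔪, hPh] at h1
        norm_cast at h1
        omega
      -- the index of `t_{i+1}`, as an opaque element of `Fin (d + 1)`
      obtain ⟨j₀, hj₀⟩ : ∃ j₀ : Fin (d + 1), (j₀ : ℕ) = i + 1 := ⟨⟨i + 1, by omega⟩, rfl⟩
      obtain ⟨y, hy, hK'⟩ := exists_le_height_sup_span_singleton hK hI (t j₀)
      refine ⟨Fin.snoc u (t j₀ + y), fun k j hkj => ?_, ?_⟩
      · induction k using Fin.lastCases with
        | last =>
          rw [Fin.val_last] at hkj
          have hj : j₀ = j := Fin.ext (by omega)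
          subst hj
          simpa using hy
        | cast k =>
          simp only [Fin.snoc_castSucc]
          exact hu k j (by simpa using hkj)
      · have hKx : Ideal.span (insert g (Set.range (Fin.snoc u (t j₀ + y) : Fin (i + 1) → R))) =
            K ⊔ Ideal.span {t j₀ + y} := by
          rw [Fin.range_snoc, Set.insert_comm, Ideal.span_insert, sup_comm]
        rw [hKx]
        exact_mod_cast hK'
  obtain ⟨u, hu, hK⟩ := key d le_rfl
  have hut : ∀ k : Fin d, u k - t k.succ ∈ maximalIdeal R * J := fun k => hu k k.succ (by simp)
  have huJ : ∀ k : Fin d, u k ∈ J := fun k => by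
    simpa using
      J.add_mem (Ideal.mul_le_left (hut k)) (Ideal.subset_span (Set.mem_range_self k.succ))
  refine ⟨t 0, u, le_antisymm ?_ ?_, ?_⟩
  · -- `J ≤ (t 0, u)` by Nakayama: `J ≤ (t 0, u) + 𝔪 • J`
    refine Submodule.le_of_le_smul_of_le_jacobson_bot (IsNoetherian.noetherian J)
      (IsLocalRing.maximalIdeal_le_jacobson ⊥) ?_
    rw [hJ_def, Ideal.span_le]
    rintro _ ⟨j, rfl⟩
    rcases Fin.eq_zero_or_eq_succ j with rfl | ⟨k, rfl⟩
    · exact Ideal.mem_sup_left (Ideal.subset_span (Set.mem_insert _ _))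
    · have htk : t k.succ = u k - (u k - t k.succ) := by ring
      rw [htk]
      exact Submodule.sub_mem _
        (Ideal.mem_sup_left (Ideal.subset_span (Set.mem_insert_of_mem _ (Set.mem_range_self k))))
        (Ideal.mem_sup_right (hut k))
  · rw [Ideal.span_le]
    rintro x (rfl | ⟨k, rfl⟩)
    · exact Ideal.subset_span (Set.mem_range_self 0)
    · exact huJ k
  · -- `rad (g, u) = 𝔪`
    have hK𝔪 : Ideal.span (insert g (Set.range u)) ≤ maximalIdeal R := by
      rw [Ideal.span_le]
      rintro x (rfl | ⟨k, rfl⟩)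
      · exact hg
      · exact hJ𝔪 (huJ k)
    refine le_antisymm ((maximalIdeal.isMaximal R).isPrime.radical_le_iff.mpr hK𝔪) ?_
    rw [Ideal.radical_eq_sInf]
    refine le_sInf ?_
    rintro P ⟨hKP, hP⟩
    -- `height P = d + 1 = dim R`, so `P = 𝔪`
    have h1 : ((d + 1 : ℕ) : ℕ∞) ≤ P.height := hK.trans (Ideal.height_mono hKP)
    have h2 := Ideal.height_le_ringKrullDim_of_ne_top hP.ne_top
    rw [hd] at h2
    have h3 : P.height = ((d + 1 : ℕ) : ℕ∞) := le_antisymm (by exact_mod_cast h2) h1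
    have hP𝔪 : P = maximalIdeal R :=
      Ideal.height_eq_ringKrullDim_iff.mp (by rw [h3, hd]; norm_cast)
    exact hP𝔪 ▸ le_rfl

end Summit.ResolutionOfSingularities.ResolutionOfSingularities.Theorems.FRationalModification.AdaptedGenerators
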